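import Literature.AlgebraicGeometry.Motives.AbelianVarietyPermutationPowerIsotypical
import Literature.AlgebraicGeometry.Motives.AbelianVarietyPermutationPowerReciprocity
import HarnessLib

/-!
# Abelian varieties tensored with an integral representation: `X = Y ⊗_ℤ M` for a `ℤ[G]`-lattice `M = (ℤ^ι, m)`
# (the Milne–Serre tensor construction with its group action), its `ℓ`-adic character
# `Tr(ρ(g) | T_ℓ X) = tr m(g) · Tr(β(g) | T_ℓ Y)`, and `|G| · dim B_W(Y ⊗ M) = (Σ_g c_W(g) tr m(g)) · dim Y`

Let `Y` be an abelian variety over a field `K`, `ι` a finite set and `X = ⊕_{i ∈ ι} Y e_i` a power of `Y` (a bicone `b` over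
`(Y)_{i ∈ ι}` with **`Σ_i π_i ≫ ι_i = 𝟙_X`**, hypothesis `hb`, as in `Motives/AbelianVarietyPermutationPowerHom`).  An INTEGRAL
MATRIX REPRESENTATION `m : G → M_ι(ℤ)`, `m(st) = m(s) m(t)` (Serre §1.1 "a representation in matrix form"), is a `ℤ[G]`-lattice
`M = ℤ^ι`, `g e_j = Σ_i m(g)_{ij} e_i`; together with an auxiliary action `β : G → End Y` it acts on `X = Y ⊗_ℤ M` by

  **`ι_j ≫ ρ(g) ≫ π_i = m(g)_{ij} • β(g)`**   (`hρ`; "`ρ_s(y ⊗ e_j) = Σ_i m_{ij}(s) β_s(y) ⊗ e_i`", Serre §1.5),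

the tensor product of `β` and `m`.  For `β = 1` (`ι_j ρ(g) π_i = m(g)_{ij} • 𝟙_Y`, hypothesis `hρ₁` below) this is the abelian
variety `M ⊗_ℤ Y` of Milne (1972, §2) and Mazur–Rubin–Silverberg (Def. 1.1: `I ⊗_𝒪 V` is `V^{rank I}` with the structure
transported along `𝒪^d ≅ I`) with the `G`-ACTION BY FUNCTORIALITY `G → Aut_ℤ(M) → Aut(M ⊗ Y)` (MRS Cor. 1.7 (i):
`Hom_𝒪(I, J) → Hom(I ⊗ V, J ⊗ V)`; Thm. 1.8: `(I, V) ↦ I ⊗ V` is a functor), i.e. the Serre–Tate object `Hom_ℤ(M^∨, Y)` of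
Jordan–Keeton–Poonen–Rains–Shepherd-Barron–Tate §4.1 — here over the base field itself (no Galois twisting: `G` acts
`K`-linearly).  The permutation powers `Y ⊗ ℤ[S]` of `Motives/AbelianVarietyPermutationPower*` are the case of a permutation
matrix representation (`blocks_of_permAction`, `permAction_of_blocks`; MRS Ex. 1.5 (iv), Prop. 4.1: `𝒪[G] ⊗ V = Res V`), the
twisted powers `ι_s ρ(g) = β(g) ι_{gs}` the case `β ⊗ ℤ[S]` (`blocks_of_twistedPermAction`).  This file proves, WITHOUT ANY NEW
DEFINITION (`m`, `β`, `ρ`, `hρ` are hypotheses; §1 shows `ρ` EXISTS and is UNIQUE for every `m`, `β`, so they are consistent):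

* §1 HOMOMORPHISMS WITH SCALAR BLOCKS between powers, `ι_j ≫ F ≫ π_k = P_{kj} • φ` for an integer matrix `P` and one
  `φ : Y → Y'` — the functorial map `Hom_ℤ(M, N) ⊗ Hom(Y, Y') → Hom(Y ⊗ M, Y' ⊗ N)` of MRS Prop. 1.6 (i) in the def-free
  form: existence `F = Σ_j π_j ≫ Σ_k (P_{kj} • φ) ≫ ι_k` (`exists_hom_of_blocks`), uniqueness (`hom_ext_of_blocks`),
  **composition `(F ≫ F')` has blocks `(Q P)_{lj} • (φ ≫ φ')`** (`blocks_comp`; Serre §1.1 `r_{ik}(st) = Σ_j r_{ij}(s) r_{jk}(t)`),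
  identity, sum and multiples; hence **existence and uniqueness of the action `ρ` of `G` on `Y ⊗ M`** (`exists_action`,
  `action_unique`; MRS Thm. 1.8), the expansions `ρ(g) = Σ_{i,j} m(g)_{ij} • π_j β(g) ι_i`, `ι_j ρ(g) = Σ_i m(g)_{ij} • β(g) ι_i`,
  `ρ(g) π_i = Σ_j m(g)_{ij} • π_j β(g)`, and the permutation / twisted-permutation examples;
* §2 THE `ℓ`-ADIC CHARACTER (`ℓ` invertible in `K`): **`Tr(F | T_ℓ X) = tr(P) · Tr(φ | T_ℓ Y)`** for a scalar-block
  endomorphism and **`Tr(ρ(g) | T_ℓ(Y ⊗ M)) = tr m(g) · Tr(β(g) | T_ℓ Y)`** (`trace_tateModuleMap_asHom_eq_trace_mul`) —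
  `T_ℓ(I ⊗ V) ≅ I ⊗ T_ℓ(V)` (MRS Thm. 2.2 (iii), Milne 1972 §2) and "the character of a tensor product is the product of the
  characters" (Serre §2.1 Prop. 2 (ii): `ψ(s) = Σ r_{i₁i₁}(s) r_{i₂i₂}(s)`); for `β = 1`, **`Tr(ρ(g) | T_ℓ X) = tr m(g) · 2 dim Y`**
  (`dim (I ⊗ V) = rank I · dim V`, MRS Thm. 2.1 (i), is the tree's `dim_permPower_eq_card_mul`);
* §3 FIXED PARTS over any field (`β = 1`; `N_H = Σ_{h ∈ H} ρ(h)`, `B_H = Im N_H` the Kani–Rosen factor): **`|H| · dim B_H(Y ⊗ M) =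
  (Σ_{h ∈ H} tr m(h)) · dim Y`** (`card_mul_dim_image_norm_eq`), i.e. `dim B_H = rank(M^H) · dim Y` since `Σ_h tr m(h) =
  |H| rank M^H` ("`(χ|1)` is the number of times `ρ` contains the unit representation", Serre §2.3) — `B_H(Y ⊗ M)` is `Y ⊗ M^H`
  up to isogeny; the twisted form `|H| · 2 dim B_H = Σ_h tr m(h) Tr(β(h) | T_ℓ Y)`;
* §4 ISOTYPICAL COMPONENTS over any field (`β = 1`; `B_W = Im u_W`, `u_W = Σ_g c_W(g) ρ(g)` the integral lift of `|G| e_W` of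
  the tree's `Motives/AbelianVarietyGroupActionIsotypicalDecomposition`): **`|G| · dim B_W(Y ⊗ M) = (Σ_g c_W(g) tr m(g)) · dim Y`**
  (`card_mul_dim_isotypical_eq`; Lange–Rodríguez Prop. 2.9.3 "`dim B_W = ½ ⟨ρ_r, W⟩`" for the character `2 dim Y · tr m`), so
  `dim B_W(Y ⊗ M) = d_W · dim Y` for `|G| d_W = Σ_g c_W(g) tr m(g)` (`d_W = dim_ℚ e_W M_ℚ`: `B_W(Y ⊗ M)` is the `ρ`-twist
  `Y ⊗ M_W`, `M_W = M ∩ e_W M_ℚ`, of MRS Def. 4.3 / Thm. 4.5 up to isogeny), with the vanishing criterion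
  **`B_W(Y ⊗ M) = 0 ⟺ dim Y = 0 ∨ Σ_g c_W(g) tr m(g) = 0`**, and the twisted form
  `|G| · 2 dim B_W = Σ_g c_W(g) tr m(g) Tr(β(g) | T_ℓ Y)`.

Scope (stated, not hidden).  `ι` finite, `K` any field, `G` arbitrary in §1–2 and finite where sums over `G` occur; the Galois
twisting of Milne / Mazur–Rubin–Silverberg (a `Gal(k^s/k)`-action on `I` producing a `k`-form of `V^d`) is NOT treated — only the
split object `Y ⊗ M` over `K` with its `G`-action; `Hom`-counts, lattice-change isogenies and equivariant homomorphisms of the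
`Y ⊗ M` are the sequels'.

## References

* [MazurRubinSilverberg2007] B. Mazur, K. Rubin, A. Silverberg, *Twisting commutative algebraic groups*, J. Algebra 314 (2007)
  419–438: Def. 1.1 (`I ⊗_𝒪 V`), Ex. 1.5 (i), (iv), Prop. 1.6 (i) (`Hom_𝒪(I, J) ⊗ Hom(V, W) ≅ Hom(I ⊗ V, J ⊗ W)` via
  `M_{m×n}(Hom(V, W)) ≅ Hom(V^n, W^m)`), Cor. 1.7, Thm. 1.8 (functoriality), Thm. 2.1 (i) (`dim = rank I · dim V`), Thm. 2.2 (iii)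
  (`T_ℓ(I ⊗ V) ≅ I ⊗ T_ℓ(V)`), Prop. 4.1, Def. 4.3, Thm. 4.5 (`Res V ∼ ⊕_ρ I_ρ ⊗ V`).  Held: `paper:doi-10-1016-j-jalgebra-2007-02-052`,
  pp. 2–7, 9–10, 14–16 read 2026-08-28.
* [Milne1972ArithmeticAV] J. S. Milne, *On the arithmetic of abelian varieties*, Invent. Math. 17 (1972) 177–190, §2 (the abelian
  variety `M ⊗ A`; Prop. 6 (b): its Tate module) — the original of the construction, as reported by [MazurRubinSilverberg2007]
  ("This construction appears in §2 of [Mi] when V is an abelian variety"; "See Proposition 6(b) of [Mi]").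
* [JordanEtAl2018] B. W. Jordan, A. G. Keeton, B. Poonen, E. M. Rains, N. Shepherd-Barron, J. T. Tate, *Abelian varieties
  isogenous to a power of an elliptic curve*, Compos. Math. 154 (2018), §4.1 (the functors `Hom_R(−, E)` and `− ⊗_R E`, Remark 4.1;
  an `R`-module map given by a matrix acts on `E^n` by that matrix), Prop. 4.3 (`dim Hom_R(M, E) = rk M · dim E`).  arXiv:1602.06237 read.
* [SerreLinearRepresentations1977] J.-P. Serre, *Linear Representations of Finite Groups*, GTM 42 (1977): §1.1 (matrix form
  `R_{st} = R_s R_t`, `r_{ik}(st) = Σ_j r_{ij}(s) r_{jk}(t)`), §1.2 (c) (permutation representation), §1.5 (tensor product; the matrix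
  of `ρ¹_s ⊗ ρ²_s` is `(r_{i₁j₁}(s) r_{i₂j₂}(s))`), §2.1 Prop. 1 (i) (`χ(1) = n`) and Prop. 2 (ii) (`χ_{V₁ ⊗ V₂} = χ₁ χ₂`), §2.3
  (`(χ|1)` counts the unit representation), §2.6 Thm. 8 (canonical decomposition).  Held:
  `book:serre1977-linear-representations-finite-groups`, PDF pp. 9, 13, 15, 19–20 read 2026-08-28.
* [LangeRodriguez2022] H. Lange, R. E. Rodríguez, *Decomposition of Jacobians by Prym Varieties*, LNM 2310 (2022), §2.9.1
  Thm. 2.9.1 and Prop. 2.9.3 (PDF pp. 43, 46: `dim B_W = ½ ⟨ρ_r, W⟩`; "`dim B = 0` iff `⟨ρ, W⟩ = 0`").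
* [KaniRosen1989] E. Kani, M. Rosen, *Idempotent relations and factors of Jacobians*, Math. Ann. 284 (1989), §3 Thm. B.
* [MumfordAV1970] D. Mumford, *Abelian Varieties* (1970), §19 Thm. 3 (p. 176), Thm. 4 (p. 180).
-/

noncomputable section

open CategoryTheory CategoryTheory.Limits
open Literature.NumberTheory.DiophantineGeometry
open Literature.RepresentationTheory.FiniteGroups

universe u

namespace Literature.AlgebraicGeometry.Motives

namespace AbelianVariety

namespace LatticeTensor

variable {K : Type u} [Field K]

/-! ## §1 Homomorphisms with scalar blocks `ι_j ≫ F ≫ π_k = P_{kj} • φ` and the action of `G` on `Y ⊗ M` -/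

section Blocks

variable {Y Y' Y'' : AbelianVariety K} {ι κ μ : Type} [Fintype ι] [Fintype κ] [Fintype μ]
  (b : Bicone (fun _ : ι ↦ Y)) (c : Bicone (fun _ : κ ↦ Y')) (d : Bicone (fun _ : μ ↦ Y''))

/-- **The blocks of `Σ_j π_j ≫ Σ_k (P_{kj} • φ) ≫ ι_k` are `P_{kj} • φ`**: the homomorphism `P ⊗ φ : Y ⊗ ℤ^ι → Y' ⊗ ℤ^κ` attached
to an integer matrix `P ∈ M_{κ×ι}(ℤ)` and one homomorphism `φ : Y → Y'` ("`M_{m×n}(𝒪) ⊗ Hom(V, W) → M_{m×n}(Hom(V, W)) ≅ Hom(V^n, W^m)`").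
[cite: MazurRubinSilverberg2007, Prop. 1.6 (i) (proof)] [cite: MumfordAV1970, §19 (p. 173)] -/
theorem blocks_sum (P : Matrix κ ι ℤ) (φ : Y ⟶ Y') (k : κ) (j : ι) :
    b.ι j ≫ (∑ j', b.π j' ≫ ∑ k', (P k' j' • φ) ≫ c.ι k') ≫ c.π k = P k j • φ :=
  ι_comp_matrix_comp_π b c (fun j' k' ↦ P k' j' • φ) j k

/-- **Existence of the homomorphism with prescribed scalar blocks** `ι_j ≫ F ≫ π_k = P_{kj} • φ` — the functorial map
`Hom_ℤ(M, N) ⊗ Hom(Y, Y') → Hom(Y ⊗ M, Y' ⊗ N)`, `P ⊗ φ ↦ P_φ`. [cite: MazurRubinSilverberg2007, Prop. 1.6 (i) and Cor. 1.7 (i)]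
[cite: JordanEtAl2018, §4.1 (an `R`-module homomorphism induces a morphism of the representing objects)] -/
theorem exists_hom_of_blocks (P : Matrix κ ι ℤ) (φ : Y ⟶ Y') :
    ∃ F : b.pt ⟶ c.pt, ∀ (k : κ) (j : ι), b.ι j ≫ F ≫ c.π k = P k j • φ :=
  ⟨∑ j', b.π j' ≫ ∑ k', (P k' j' • φ) ≫ c.ι k', fun k j ↦ blocks_sum b c P φ k j⟩

/-- **Expansion of a scalar-block homomorphism**: `F = Σ_j π_j ≫ Σ_k (P_{kj} • φ) ≫ ι_k` (uses `Σ π ≫ ι = 𝟙` on both powers).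
[cite: MazurRubinSilverberg2007, Prop. 1.6 (i) (proof)] [cite: MumfordAV1970, §19 (p. 173)] -/
theorem eq_sum_of_blocks (hb : ∑ j, b.π j ≫ b.ι j = 𝟙 b.pt) (hc : ∑ k, c.π k ≫ c.ι k = 𝟙 c.pt) {F : b.pt ⟶ c.pt}
    {P : Matrix κ ι ℤ} {φ : Y ⟶ Y'} (hF : ∀ (k : κ) (j : ι), b.ι j ≫ F ≫ c.π k = P k j • φ) :
    F = ∑ j, b.π j ≫ ∑ k, (P k j • φ) ≫ c.ι k := by
  conv_lhs => rw [eq_sum_matrix b c hb hc F]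
  simp only [hF]

/-- **Uniqueness**: a homomorphism between powers is determined by its blocks; two homomorphisms with the same scalar blocks
`P_{kj} • φ` are equal (injectivity in MRS Prop. 1.6). [cite: MazurRubinSilverberg2007, Prop. 1.6 (i)] [cite: MumfordAV1970, §19 (p. 173)] -/
theorem hom_ext_of_blocks (hb : ∑ j, b.π j ≫ b.ι j = 𝟙 b.pt) (hc : ∑ k, c.π k ≫ c.ι k = 𝟙 c.pt) {F F' : b.pt ⟶ c.pt}
    {P : Matrix κ ι ℤ} {φ : Y ⟶ Y'} (hF : ∀ (k : κ) (j : ι), b.ι j ≫ F ≫ c.π k = P k j • φ)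
    (hF' : ∀ (k : κ) (j : ι), b.ι j ≫ F' ≫ c.π k = P k j • φ) : F = F' :=
  hom_ext_matrix b c hb hc fun j k ↦ by rw [hF, hF']

omit [Fintype ι] [Fintype μ] in
/-- **Composition multiplies the matrices and composes the twists**: if `F : Y ⊗ ℤ^ι → Y' ⊗ ℤ^κ` has blocks `P_{kj} • φ` and
`F' : Y' ⊗ ℤ^κ → Y'' ⊗ ℤ^μ` has blocks `Q_{lk} • φ'`, then `F ≫ F'` has blocks **`(Q P)_{lj} • (φ ≫ φ')`** — the matrix rule
`r_{ik}(st) = Σ_j r_{ij}(s) r_{jk}(t)` / functoriality of `(I, V) ↦ I ⊗ V`. [cite: SerreLinearRepresentations1977, §1.1]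
[cite: MazurRubinSilverberg2007, Thm. 1.8] -/
theorem blocks_comp (hc : ∑ k, c.π k ≫ c.ι k = 𝟙 c.pt) {F : b.pt ⟶ c.pt} {F' : c.pt ⟶ d.pt} {P : Matrix κ ι ℤ}
    {Q : Matrix μ κ ℤ} {φ : Y ⟶ Y'} {φ' : Y' ⟶ Y''} (hF : ∀ (k : κ) (j : ι), b.ι j ≫ F ≫ c.π k = P k j • φ)
    (hF' : ∀ (l : μ) (k : κ), c.ι k ≫ F' ≫ d.π l = Q l k • φ') (l : μ) (j : ι) :
    b.ι j ≫ (F ≫ F') ≫ d.π l = (Q * P) l j • (φ ≫ φ') := by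
  have h : F ≫ F' = ∑ k, (F ≫ c.π k) ≫ (c.ι k ≫ F') := by
    conv_lhs => rw [← Category.comp_id F, ← hc, Preadditive.comp_sum, Preadditive.sum_comp]
    simp only [Category.assoc]
  rw [h, Preadditive.sum_comp, Preadditive.comp_sum, Matrix.mul_apply, Finset.sum_smul]
  refine Finset.sum_congr rfl fun k _ ↦ ?_
  have e : b.ι j ≫ ((F ≫ c.π k) ≫ c.ι k ≫ F') ≫ d.π l = (b.ι j ≫ F ≫ c.π k) ≫ (c.ι k ≫ F' ≫ d.π l) := by
    simp only [Category.assoc]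
  rw [e, hF, hF', Preadditive.zsmul_comp, Preadditive.comp_zsmul, smul_smul, mul_comm]

omit [Fintype ι] in
/-- The identity has blocks `δ_{ij} • 𝟙_Y` — the identity matrix. [cite: SerreLinearRepresentations1977, §1.1] -/
theorem blocks_id [DecidableEq ι] (i j : ι) : b.ι j ≫ 𝟙 b.pt ≫ b.π i = (1 : Matrix ι ι ℤ) i j • 𝟙 Y := by
  rw [Category.id_comp, bicone_ι_π_eq_ite, Matrix.one_apply]
  by_cases h : i = j
  · subst h
    simp
  · rw [if_neg (Ne.symm h), if_neg h, zero_smul]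

omit [Fintype ι] [Fintype κ] in
/-- Sums: `F + F'` has blocks `(P + P')_{kj} • φ` (the map `Hom_ℤ(M, N) → Hom(Y ⊗ M, Y ⊗ N)` is additive).
[cite: MazurRubinSilverberg2007, Prop. 1.6 (i) (an `𝒪`-module homomorphism)] -/
theorem blocks_add {F F' : b.pt ⟶ c.pt} {P P' : Matrix κ ι ℤ} {φ : Y ⟶ Y'}
    (hF : ∀ (k : κ) (j : ι), b.ι j ≫ F ≫ c.π k = P k j • φ) (hF' : ∀ (k : κ) (j : ι), b.ι j ≫ F' ≫ c.π k = P' k j • φ)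
    (k : κ) (j : ι) : b.ι j ≫ (F + F') ≫ c.π k = (P + P') k j • φ := by
  rw [Preadditive.add_comp, Preadditive.comp_add, hF, hF', Matrix.add_apply, add_smul]

omit [Fintype ι] [Fintype κ] in
/-- Multiples: `n • F` has blocks `(n • P)_{kj} • φ`. [cite: MazurRubinSilverberg2007, Prop. 1.6 (i)] -/
theorem blocks_zsmul {F : b.pt ⟶ c.pt} {P : Matrix κ ι ℤ} {φ : Y ⟶ Y'}
    (hF : ∀ (k : κ) (j : ι), b.ι j ≫ F ≫ c.π k = P k j • φ) (n : ℤ) (k : κ) (j : ι) :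
    b.ι j ≫ (n • F) ≫ c.π k = (n • P) k j • φ := by
  rw [Preadditive.zsmul_comp, Preadditive.comp_zsmul, hF, Matrix.smul_apply, smul_eq_mul, mul_smul]

omit [Fintype ι] [Fintype κ] in
/-- The same homomorphism read with the twist on the other side: blocks `P_{kj} • φ` with `φ = n • ψ` are blocks
`(n • P)_{kj} • ψ` (integer scalars move freely between the lattice and the abelian variety). [cite: MazurRubinSilverberg2007, Prop. 1.6 (i)] -/
theorem blocks_of_twist_zsmul {F : b.pt ⟶ c.pt} {P : Matrix κ ι ℤ} {ψ : Y ⟶ Y'} {n : ℤ}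
    (hF : ∀ (k : κ) (j : ι), b.ι j ≫ F ≫ c.π k = P k j • (n • ψ)) (k : κ) (j : ι) :
    b.ι j ≫ F ≫ c.π k = (n • P) k j • ψ := by
  rw [hF, Matrix.smul_apply, smul_eq_mul, smul_smul, mul_comm]

end Blocks

section Action

variable {Y : AbelianVariety K} {ι : Type} [Fintype ι] [DecidableEq ι] (b : Bicone (fun _ : ι ↦ Y))
  {G : Type} [Group G] (m : G →* Matrix ι ι ℤ) (β : G →* End Y) (ρ : G →* End b.pt)

/-- **Existence of the action of `G` on `Y ⊗ M`**: for every integral matrix representation `m : G → M_ι(ℤ)` (a `ℤ[G]`-lattice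
`M = ℤ^ι`) and every action `β : G → End Y` there is an action `ρ : G → End(Y^ι)` with **`ι_j ≫ ρ(g) ≫ π_i = m(g)_{ij} • β(g)`**,
namely `ρ(g) = Σ_j π_j ≫ Σ_i (m(g)_{ij} • β(g)) ≫ ι_i` — a homomorphism by the block rule (`m(gh) = m(g) m(h)`,
`β(gh) = β(g) β(h)`) and `ρ(1) = Σ_i π_i ι_i = 𝟙`.  For `β = 1` this is the action of `G` on Milne's `M ⊗ Y` by functoriality
`G → Aut_{ℤ[G]}… → Aut_ℤ(M) → Aut(M ⊗ Y)`. [cite: MazurRubinSilverberg2007, Def. 1.1, Cor. 1.7 (i) and Thm. 1.8]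
[cite: SerreLinearRepresentations1977, §1.1 (matrix form) and §1.5 (tensor product)] [cite: Milne1972ArithmeticAV, §2] -/
theorem exists_action (hb : ∑ j, b.π j ≫ b.ι j = 𝟙 b.pt) :
    ∃ ρ : G →* End b.pt, ∀ (g : G) (i j : ι), b.ι j ≫ End.asHom (ρ g) ≫ b.π i = m g i j • End.asHom (β g) := by
  have blk : ∀ (g : G) (i j : ι),
      b.ι j ≫ (∑ j', b.π j' ≫ ∑ i', (m g i' j' • End.asHom (β g)) ≫ b.ι i') ≫ b.π i = m g i j • End.asHom (β g) :=
    fun g i j ↦ blocks_sum b b (m g) (End.asHom (β g)) i j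
  refine ⟨{ toFun := fun g ↦ End.of (∑ j', b.π j' ≫ ∑ i', (m g i' j' • End.asHom (β g)) ≫ b.ι i')
            map_one' := ?_
            map_mul' := ?_ }, fun g i j ↦ blk g i j⟩
  · change (∑ j', b.π j' ≫ ∑ i', (m 1 i' j' • End.asHom (β 1)) ≫ b.ι i') = 𝟙 b.pt
    refine hom_ext_of_blocks b b hb hb (P := (1 : Matrix ι ι ℤ)) (φ := 𝟙 Y) (fun i j ↦ ?_) (fun i j ↦ blocks_id b i j)
    rw [blk 1 i j, map_one m, asHom_map_one_eq_id β]
  · intro g h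
    change (∑ j', b.π j' ≫ ∑ i', (m (g * h) i' j' • End.asHom (β (g * h))) ≫ b.ι i') =
      (∑ j', b.π j' ≫ ∑ i', (m h i' j' • End.asHom (β h)) ≫ b.ι i') ≫
        (∑ j', b.π j' ≫ ∑ i', (m g i' j' • End.asHom (β g)) ≫ b.ι i')
    refine hom_ext_of_blocks b b hb hb (P := m g * m h) (φ := End.asHom (β h) ≫ End.asHom (β g))
      (fun i j ↦ ?_) (fun i j ↦ blocks_comp b b b hb (blk h) (blk g) i j)
    rw [blk (g * h) i j, map_mul m, asHom_map_mul_eq_comp β]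

/-- **Uniqueness of the action**: `ρ` is determined by `ι_j ≫ ρ(g) ≫ π_i = m(g)_{ij} • β(g)`.
[cite: MazurRubinSilverberg2007, Prop. 1.6 (i) and Cor. 1.7] [cite: SerreLinearRepresentations1977, §1.1] -/
theorem action_unique (hb : ∑ j, b.π j ≫ b.ι j = 𝟙 b.pt) {ρ ρ' : G →* End b.pt}
    (hρ : ∀ (g : G) (i j : ι), b.ι j ≫ End.asHom (ρ g) ≫ b.π i = m g i j • End.asHom (β g))
    (hρ' : ∀ (g : G) (i j : ι), b.ι j ≫ End.asHom (ρ' g) ≫ b.π i = m g i j • End.asHom (β g)) : ρ = ρ' :=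
  MonoidHom.ext fun g ↦ show End.asHom (ρ g) = End.asHom (ρ' g) from hom_ext_of_blocks b b hb hb (hρ g) (hρ' g)

/-- **`ρ(g) = Σ_j π_j ≫ Σ_i (m(g)_{ij} • β(g)) ≫ ι_i`** ("the matrix of `ρ¹_s ⊗ ρ²_s` is `(r_{i₁j₁}(s) r_{i₂j₂}(s))`").
[cite: SerreLinearRepresentations1977, §1.5] [cite: MazurRubinSilverberg2007, Prop. 1.6 (i)] -/
theorem asHom_eq_sum (hb : ∑ j, b.π j ≫ b.ι j = 𝟙 b.pt)
    (hρ : ∀ (g : G) (i j : ι), b.ι j ≫ End.asHom (ρ g) ≫ b.π i = m g i j • End.asHom (β g)) (g : G) :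
    End.asHom (ρ g) = ∑ j, b.π j ≫ ∑ i, (m g i j • End.asHom (β g)) ≫ b.ι i :=
  eq_sum_of_blocks b b hb hb (hρ g)

/-- **`ι_j ≫ ρ(g) = Σ_i m(g)_{ij} • (β(g) ≫ ι_i)`** — "`ρ_s(y ⊗ e_j) = Σ_i r_{ij}(s) · β_s(y) ⊗ e_i`": the summand `Y e_j` is mapped to
the combination `Σ_i m(g)_{ij} Y e_i`. [cite: SerreLinearRepresentations1977, §1.5 (`ρ_s(e_{j₁}·e_{j₂}) = Σ r_{i₁j₁}(s) r_{i₂j₂}(s) e_{i₁}·e_{i₂}`)] -/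
theorem ι_comp_asHom_eq_sum (hb : ∑ j, b.π j ≫ b.ι j = 𝟙 b.pt)
    (hρ : ∀ (g : G) (i j : ι), b.ι j ≫ End.asHom (ρ g) ≫ b.π i = m g i j • End.asHom (β g)) (g : G) (j : ι) :
    b.ι j ≫ End.asHom (ρ g) = ∑ i, m g i j • (End.asHom (β g) ≫ b.ι i) := by
  conv_lhs => rw [eq_sum_comp_π_comp_ι b hb (b.ι j ≫ End.asHom (ρ g))]
  refine Finset.sum_congr rfl fun i _ ↦ ?_
  simp only [Category.assoc]
  rw [reassoc_of% (hρ g i j), Preadditive.zsmul_comp]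

/-- **`ρ(g) ≫ π_i = Σ_j m(g)_{ij} • (π_j ≫ β(g))`**: the `i`-th coordinate of `ρ(g) x` is `β(g)` of the combination
`Σ_j m(g)_{ij} x_j` of the coordinates of `x`. [cite: SerreLinearRepresentations1977, §1.1 and §1.5] -/
theorem asHom_comp_π_eq_sum (hb : ∑ j, b.π j ≫ b.ι j = 𝟙 b.pt)
    (hρ : ∀ (g : G) (i j : ι), b.ι j ≫ End.asHom (ρ g) ≫ b.π i = m g i j • End.asHom (β g)) (g : G) (i : ι) :
    End.asHom (ρ g) ≫ b.π i = ∑ j, m g i j • (b.π j ≫ End.asHom (β g)) := by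
  conv_lhs => rw [eq_sum_π_comp_ι_comp b hb (End.asHom (ρ g) ≫ b.π i)]
  refine Finset.sum_congr rfl fun j _ ↦ ?_
  rw [hρ g i j, Preadditive.comp_zsmul]

omit [Fintype ι] in
/-- **Permutation powers are lattice tensors with the permutation matrix**: if `ι_s ≫ ρ(g) = ι_{g s}` (the permutation action
on `Y ⊗ ℤ[S]` of `Motives/AbelianVarietyPermutationPowerHom`), then `ι_j ≫ ρ(g) ≫ π_i = δ_{g j, i} • 𝟙_Y` — the matrix
representation `g e_j = e_{g j}` with the trivial twist (`𝒪[G] ⊗_𝒪 V`, `ℤ[G/H] ⊗ V`). [cite: MazurRubinSilverberg2007, Ex. 1.5 (iv) and Prop. 4.1]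
[cite: SerreLinearRepresentations1977, §1.2 (c)] -/
theorem blocks_of_permAction [MulAction G ι] (hρ : ∀ (g : G) (s : ι), b.ι s ≫ End.asHom (ρ g) = b.ι (g • s)) (g : G)
    (i j : ι) : b.ι j ≫ End.asHom (ρ g) ≫ b.π i = (if g • j = i then (1 : ℤ) else 0) • 𝟙 Y := by
  rw [ι_comp_asHom_permAction_comp_π b ρ hρ g j i]
  split_ifs <;> simp

omit [Fintype ι] in
/-- **Twisted permutation powers `ι_s ≫ ρ(g) = β(g) ≫ ι_{g s}` are the lattice tensors `β ⊗ ℤ[S]`**: blocks `δ_{g j, i} • β(g)`.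
[cite: SerreLinearRepresentations1977, §1.5 and §3.3 Example 5] [cite: MazurRubinSilverberg2007, Ex. 1.5 (iv)] -/
theorem blocks_of_twistedPermAction [MulAction G ι]
    (hρ : ∀ (g : G) (s : ι), b.ι s ≫ End.asHom (ρ g) = End.asHom (β g) ≫ b.ι (g • s)) (g : G) (i j : ι) :
    b.ι j ≫ End.asHom (ρ g) ≫ b.π i = (if g • j = i then (1 : ℤ) else 0) • End.asHom (β g) := by
  rw [← Category.assoc, hρ, Category.assoc, bicone_ι_π_eq_ite]
  split_ifs <;> simp

/-- Conversely, **an action with permutation-matrix blocks `δ_{g j, i} • 𝟙_Y` is the permutation action** `ι_s ≫ ρ(g) = ι_{g s}`: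
`ℤ[S] ⊗ Y` IS the permutation power `Y^S` with its permutation action. [cite: MazurRubinSilverberg2007, Prop. 4.1 (`𝒪[G] ⊗ V = Res V`)]
[cite: SerreLinearRepresentations1977, §1.2 (c)] -/
theorem permAction_of_blocks [MulAction G ι] (hb : ∑ j, b.π j ≫ b.ι j = 𝟙 b.pt)
    (hρ : ∀ (g : G) (i j : ι), b.ι j ≫ End.asHom (ρ g) ≫ b.π i = (if g • j = i then (1 : ℤ) else 0) • 𝟙 Y)
    (g : G) (s : ι) : b.ι s ≫ End.asHom (ρ g) = b.ι (g • s) := by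
  refine hom_ext_π b hb fun i ↦ ?_
  rw [Category.assoc, hρ g i s, bicone_ι_π_eq_ite]
  split_ifs <;> simp

end Action

/-! ## §2 The `ℓ`-adic character: `Tr(ρ(g) | T_ℓ(Y ⊗ M)) = tr m(g) · Tr(β(g) | T_ℓ Y)` -/

section Character

variable (ℓ : ℕ) [Fact ℓ.Prime] {Y : AbelianVariety K} {ι : Type} [Fintype ι] [DecidableEq ι]
  (b : Bicone (fun _ : ι ↦ Y)) {G : Type} [Group G] (m : G →* Matrix ι ι ℤ) (β : G →* End Y) (ρ : G →* End b.pt)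

omit [DecidableEq ι] in
/-- **`Tr(F | T_ℓ X) = tr(P) · Tr(φ | T_ℓ Y)` for an endomorphism with scalar blocks `ι_j ≫ F ≫ π_i = P_{ij} • φ`** (`ℓ` invertible
in `K`): the trace on the power is the sum of the traces of the diagonal blocks `P_{ii} • φ` — `T_ℓ(I ⊗ V) ≅ I ⊗ T_ℓ(V)` and the
trace of a tensor product of matrices is the product of the traces. [cite: MazurRubinSilverberg2007, Thm. 2.2 (iii)]
[cite: SerreLinearRepresentations1977, §2.1 Prop. 2 (ii) (`ψ(s) = Σ r_{i₁i₁}(s) r_{i₂i₂}(s) = χ₁(s) χ₂(s)`)] [cite: MumfordAV1970, §19 Thm. 4 (p. 180)] -/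
theorem trace_tateModuleMap_eq_trace_mul_of_blocks (hb : ∑ j, b.π j ≫ b.ι j = 𝟙 b.pt) (hℓ : (ℓ : K) ≠ 0) {F : b.pt ⟶ b.pt}
    {P : Matrix ι ι ℤ} {φ : Y ⟶ Y} (hF : ∀ i j : ι, b.ι j ≫ F ≫ b.π i = P i j • φ) :
    LinearMap.trace ℤ_[ℓ] (b.pt.tateModule ℓ) (tateModuleMap ℓ F) =
      (P.trace : ℤ_[ℓ]) * LinearMap.trace ℤ_[ℓ] (Y.tateModule ℓ) (tateModuleMap ℓ φ) := by
  rw [trace_tateModuleMap_permPower_eq_sum ℓ b hb hℓ F, Matrix.trace, Int.cast_sum, Finset.sum_mul]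
  refine Finset.sum_congr rfl fun i _ ↦ ?_
  rw [hF i i, tateModuleMap_zsmul, map_zsmul, zsmul_eq_mul, Matrix.diag_apply]

/-- **THE CHARACTER OF `Y ⊗ M`: `Tr(ρ(g) | T_ℓ(Y ⊗ M)) = tr m(g) · Tr(β(g) | T_ℓ Y)`** (`ℓ` invertible in `K`) — the `ℓ`-adic
representation of `Y ⊗ M` is the tensor product `T_ℓ(Y) ⊗_ℤ M` (`T_ℓ(I ⊗ V) ≅ I ⊗ T_ℓ(V)`), and the character of a tensor product is
the product of the characters. [cite: MazurRubinSilverberg2007, Thm. 2.2 (iii)] [cite: Milne1972ArithmeticAV, §2 Prop. 6 (b)]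
[cite: SerreLinearRepresentations1977, §2.1 Prop. 2 (ii)] -/
theorem trace_tateModuleMap_asHom_eq_trace_mul (hb : ∑ j, b.π j ≫ b.ι j = 𝟙 b.pt)
    (hρ : ∀ (g : G) (i j : ι), b.ι j ≫ End.asHom (ρ g) ≫ b.π i = m g i j • End.asHom (β g)) (hℓ : (ℓ : K) ≠ 0) (g : G) :
    LinearMap.trace ℤ_[ℓ] (b.pt.tateModule ℓ) (tateModuleMap ℓ (End.asHom (ρ g))) =
      ((m g).trace : ℤ_[ℓ]) * LinearMap.trace ℤ_[ℓ] (Y.tateModule ℓ) (tateModuleMap ℓ (End.asHom (β g))) :=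
  trace_tateModuleMap_eq_trace_mul_of_blocks ℓ b hb hℓ (hρ g)

/-- **`Tr(ρ(g) | T_ℓ(Y ⊗ M)) = tr m(g) · 2 dim Y` for the untwisted tensor** `ι_j ≫ ρ(g) ≫ π_i = m(g)_{ij} • 𝟙_Y` (Milne's `M ⊗ Y`
with `G` acting through `M`; `Tr(𝟙 | T_ℓ Y) = 2 dim Y`). [cite: MazurRubinSilverberg2007, Thm. 2.1 (i) and Thm. 2.2 (iii)]
[cite: SerreLinearRepresentations1977, §2.1 Prop. 1 (i) and Prop. 2 (ii)] [cite: MumfordAV1970, §19 Thm. 4 (p. 180)] -/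
theorem trace_tateModuleMap_asHom_eq_trace_mul_dim (hb : ∑ j, b.π j ≫ b.ι j = 𝟙 b.pt)
    (hρ₁ : ∀ (g : G) (i j : ι), b.ι j ≫ End.asHom (ρ g) ≫ b.π i = m g i j • 𝟙 Y) (hℓ : (ℓ : K) ≠ 0) (g : G) :
    LinearMap.trace ℤ_[ℓ] (b.pt.tateModule ℓ) (tateModuleMap ℓ (End.asHom (ρ g))) =
      ((m g).trace : ℤ_[ℓ]) * ((2 * Y.dim : ℕ) : ℤ_[ℓ]) := by
  rw [trace_tateModuleMap_eq_trace_mul_of_blocks ℓ b hb hℓ (hρ₁ g), trace_tateModuleMap_id_eq_two_mul_dim ℓ Y hℓ]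

end Character

/-! ## §3 Fixed parts: `|H| · dim B_H(Y ⊗ M) = (Σ_{h ∈ H} tr m(h)) · dim Y` over any field -/

section FixedPart

variable {Y : AbelianVariety K} {ι : Type} [Fintype ι] [DecidableEq ι] (b : Bicone (fun _ : ι ↦ Y))
  {G : Type} [Group G] (m : G →* Matrix ι ι ℤ) (β : G →* End Y) (ρ : G →* End b.pt)

/-- **`|H| · 2 dim B_H = Σ_{h ∈ H} tr m(h) · Tr(β(h) | T_ℓ Y)`** for the factor `B_H = Im N_H`, `N_H = Σ_{h ∈ H} ρ(h)`, of the twisted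
tensor `β ⊗ M` (`H` a finite subgroup, `ℓ` invertible in `K`): `|H| · 2 dim B_H = Σ_h χ_X(h)` (the tree's
`card_mul_two_mul_dim_image_norm_eq_sum_trace_tateModuleMap`) and §2. [cite: LangeRodriguez2022, §2.9.1 Prop. 2.9.3 (PDF p. 46)]
[cite: SerreLinearRepresentations1977, §2.1 Prop. 2 (ii) and §2.3] [cite: KaniRosen1989, §3 Thm. B] -/
theorem card_mul_two_mul_dim_image_norm_eq_sum_trace_mul (ℓ : ℕ) [Fact ℓ.Prime] {H : Subgroup G} [Fintype H]
    (hb : ∑ j, b.π j ≫ b.ι j = 𝟙 b.pt)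
    (hρ : ∀ (g : G) (i j : ι), b.ι j ≫ End.asHom (ρ g) ≫ b.π i = m g i j • End.asHom (β g)) (hℓ : (ℓ : K) ≠ 0)
    {N : b.pt ⟶ b.pt} (hN : End.of N = ∑ h : H, ρ h) :
    ((Fintype.card H * (2 * (image N).dim) : ℕ) : ℤ_[ℓ]) =
      ∑ h : H, ((m h).trace : ℤ_[ℓ]) * LinearMap.trace ℤ_[ℓ] (Y.tateModule ℓ) (tateModuleMap ℓ (End.asHom (β h))) := by
  rw [card_mul_two_mul_dim_image_norm_eq_sum_trace_tateModuleMap ℓ ρ hN hℓ]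
  exact Finset.sum_congr rfl fun h _ ↦ trace_tateModuleMap_asHom_eq_trace_mul ℓ b m β ρ hb hρ hℓ (h : G)

/-- **`|H| · dim B_H(Y ⊗ M) = (Σ_{h ∈ H} tr m(h)) · dim Y`** over ANY field for the untwisted tensor (`ι_j ρ(g) π_i = m(g)_{ij} • 𝟙`)
and a finite subgroup `H` (`B_H = Im Σ_{h ∈ H} ρ(h)`): with `Σ_h tr m(h) = |H| · rank M^H` ("`(χ|1)` is the number of times the
unit representation occurs") this is `dim B_H(Y ⊗ M) = rank(M^H) · dim Y` — `B_H(Y ⊗ M)` is `Y ⊗ M^H` up to isogeny.  Proof: an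
auxiliary prime `ℓ` invertible in `K` and the previous formula with `Tr(𝟙 | T_ℓ Y) = 2 dim Y`.
[cite: SerreLinearRepresentations1977, §2.3 Thm. 4 Cor. and Ex. 2.6 (a)] [cite: MazurRubinSilverberg2007, Thm. 2.1 (i) and Thm. 2.2 (iii)]
[cite: LangeRodriguez2022, §2.9.1 Prop. 2.9.3 (PDF p. 46)] [cite: KaniRosen1989, §3 Thm. B] -/
theorem card_mul_dim_image_norm_eq {H : Subgroup G} [Fintype H] (hb : ∑ j, b.π j ≫ b.ι j = 𝟙 b.pt)
    (hρ₁ : ∀ (g : G) (i j : ι), b.ι j ≫ End.asHom (ρ g) ≫ b.π i = m g i j • 𝟙 Y)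
    {N : b.pt ⟶ b.pt} (hN : End.of N = ∑ h : H, ρ h) :
    ((Fintype.card H * (image N).dim : ℕ) : ℤ) = (∑ h : H, (m h).trace) * Y.dim := by
  obtain ⟨ℓ, hℓp, hℓ⟩ := exists_prime_natCast_ne_zero (K := K)
  haveI : Fact ℓ.Prime := ⟨hℓp⟩
  have key := card_mul_two_mul_dim_image_norm_eq_sum_trace_tateModuleMap ℓ ρ hN hℓ
  simp_rw [trace_tateModuleMap_asHom_eq_trace_mul_dim ℓ b m ρ hb hρ₁ hℓ] at key
  push_cast at key
  simp_rw [← mul_assoc] at key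
  rw [← Finset.sum_mul, ← Finset.sum_mul] at key
  have key' : (((Fintype.card H * (image N).dim : ℕ) : ℤ) : ℤ_[ℓ]) * 2 =
      ((((∑ h : H, (m h).trace) * Y.dim : ℤ)) : ℤ_[ℓ]) * 2 := by
    push_cast
    linear_combination key
  exact_mod_cast (mul_left_injective₀ (two_ne_zero' ℤ_[ℓ]) key' : _)

/-- **`dim B_H(Y ⊗ M) = d · dim Y` whenever `|H| · d = Σ_{h ∈ H} tr m(h)`** (i.e. `d = rank M^H`; any field, untwisted tensor).
[cite: SerreLinearRepresentations1977, §2.3 Thm. 4 Cor. and Ex. 2.6 (a)] [cite: MazurRubinSilverberg2007, Thm. 2.1 (i)] -/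
theorem dim_image_norm_eq_of_card_mul_eq {H : Subgroup G} [Fintype H] (hb : ∑ j, b.π j ≫ b.ι j = 𝟙 b.pt)
    (hρ₁ : ∀ (g : G) (i j : ι), b.ι j ≫ End.asHom (ρ g) ≫ b.π i = m g i j • 𝟙 Y)
    {N : b.pt ⟶ b.pt} (hN : End.of N = ∑ h : H, ρ h) {d : ℕ} (hd : (Fintype.card H : ℤ) * d = ∑ h : H, (m h).trace) :
    (image N).dim = d * Y.dim := by
  have h := card_mul_dim_image_norm_eq b m ρ hb hρ₁ hN
  rw [← hd, mul_assoc, Nat.cast_mul] at h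
  exact_mod_cast mul_left_cancel₀ (Nat.cast_ne_zero.2 Fintype.card_ne_zero : (Fintype.card H : ℤ) ≠ 0) h

/-- **`|G| · dim B_G(Y ⊗ M) = (Σ_{g ∈ G} tr m(g)) · dim Y`**, the whole-group form (`G` finite, `B_G = Im Σ_g ρ(g)`, any field):
`dim (Y ⊗ M)^G = rank(M^G) · dim Y` up to isogeny. [cite: SerreLinearRepresentations1977, §2.3 Thm. 4 Cor. and Ex. 2.6 (a)]
[cite: MazurRubinSilverberg2007, Thm. 2.1 (i) and Thm. 2.2 (iii)] [cite: LangeRodriguez2022, §2.9.1 Prop. 2.9.3 (PDF p. 46)] -/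
theorem card_mul_dim_image_normG_eq [Fintype G] (hb : ∑ j, b.π j ≫ b.ι j = 𝟙 b.pt)
    (hρ₁ : ∀ (g : G) (i j : ι), b.ι j ≫ End.asHom (ρ g) ≫ b.π i = m g i j • 𝟙 Y)
    {NG : b.pt ⟶ b.pt} (hNG : End.of NG = ∑ g, ρ g) :
    ((Fintype.card G * (image NG).dim : ℕ) : ℤ) = (∑ g, (m g).trace) * Y.dim := by
  obtain ⟨ℓ, hℓp, hℓ⟩ := exists_prime_natCast_ne_zero (K := K)
  haveI : Fact ℓ.Prime := ⟨hℓp⟩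
  have key := card_mul_two_mul_dim_image_normG_eq_sum_trace_tateModuleMap ℓ ρ hNG hℓ
  simp_rw [trace_tateModuleMap_asHom_eq_trace_mul_dim ℓ b m ρ hb hρ₁ hℓ] at key
  push_cast at key
  simp_rw [← mul_assoc] at key
  rw [← Finset.sum_mul, ← Finset.sum_mul] at key
  have key' : (((Fintype.card G * (image NG).dim : ℕ) : ℤ) : ℤ_[ℓ]) * 2 =
      ((((∑ g, (m g).trace) * Y.dim : ℤ)) : ℤ_[ℓ]) * 2 := by
    push_cast
    linear_combination key
  exact_mod_cast (mul_left_injective₀ (two_ne_zero' ℤ_[ℓ]) key' : _)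

/-- **`dim B_G(Y ⊗ M) = d · dim Y` whenever `|G| · d = Σ_g tr m(g)`** (`d = rank M^G`; any field).
[cite: SerreLinearRepresentations1977, §2.3 Thm. 4 Cor. and Ex. 2.6 (a)] [cite: MazurRubinSilverberg2007, Thm. 2.1 (i)] -/
theorem dim_image_normG_eq_of_card_mul_eq [Fintype G] (hb : ∑ j, b.π j ≫ b.ι j = 𝟙 b.pt)
    (hρ₁ : ∀ (g : G) (i j : ι), b.ι j ≫ End.asHom (ρ g) ≫ b.π i = m g i j • 𝟙 Y)
    {NG : b.pt ⟶ b.pt} (hNG : End.of NG = ∑ g, ρ g) {d : ℕ} (hd : (Fintype.card G : ℤ) * d = ∑ g, (m g).trace) :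
    (image NG).dim = d * Y.dim := by
  have h := card_mul_dim_image_normG_eq b m ρ hb hρ₁ hNG
  rw [← hd, mul_assoc, Nat.cast_mul] at h
  exact_mod_cast mul_left_cancel₀ (Nat.cast_ne_zero.2 Fintype.card_ne_zero : (Fintype.card G : ℤ) ≠ 0) h

end FixedPart

/-! ## §4 Isotypical components: `|G| · dim B_W(Y ⊗ M) = (Σ_g c_W(g) tr m(g)) · dim Y` over any field -/

section Isotypical

variable {Y : AbelianVariety K} {ι : Type} [Fintype ι] [DecidableEq ι] (b : Bicone (fun _ : ι ↦ Y))
  {G : Type} [Group G] [Fintype G] (m : G →* Matrix ι ι ℤ) (β : G →* End Y) (ρ : G →* End b.pt)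
  {c : ratCharIdempotents G → G → ℤ}
  (hc : ∀ e : ratCharIdempotents G,
    (Fintype.card G : ℚ) • (e : MonoidAlgebra ℚ G) = ∑ g, (c e g : ℚ) • MonoidAlgebra.of ℚ G g)
  {u : ratCharIdempotents G → (b.pt ⟶ b.pt)} (hu : ∀ e, End.of (u e) = ∑ g, c e g • ρ g)

include hc hu

/-- **`|G| · 2 dim B_W = Σ_g c_W(g) · tr m(g) · Tr(β(g) | T_ℓ Y)`** for the isotypical component `B_W = Im u_W`,
`u_W = Σ_g c_W(g) ρ(g)` (the integral lift of `|G| e_W`), of the twisted tensor `β ⊗ M` (`ℓ` invertible in `K`): "`dim B_W = ½ ⟨ρ_r, W⟩`"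
for the character `ρ_r = χ_β · tr m`. [cite: LangeRodriguez2022, §2.9.1 Thm. 2.9.1 and Prop. 2.9.3 (PDF pp. 43, 46)]
[cite: SerreLinearRepresentations1977, §2.1 Prop. 2 (ii) and §2.6 Thm. 8] -/
theorem card_mul_two_mul_dim_isotypical_eq_sum_trace_mul (ℓ : ℕ) [Fact ℓ.Prime] (hb : ∑ j, b.π j ≫ b.ι j = 𝟙 b.pt)
    (hρ : ∀ (g : G) (i j : ι), b.ι j ≫ End.asHom (ρ g) ≫ b.π i = m g i j • End.asHom (β g)) (hℓ : (ℓ : K) ≠ 0)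
    (e : ratCharIdempotents G) :
    ((Fintype.card G * (2 * (image (u e)).dim) : ℕ) : ℤ_[ℓ]) =
      ∑ g, (c e g : ℤ_[ℓ]) *
        (((m g).trace : ℤ_[ℓ]) * LinearMap.trace ℤ_[ℓ] (Y.tateModule ℓ) (tateModuleMap ℓ (End.asHom (β g)))) := by
  rw [card_mul_two_mul_dim_isotypical_eq_sum ℓ ρ hc hu hℓ e]
  exact Finset.sum_congr rfl fun g _ ↦ by rw [trace_tateModuleMap_asHom_eq_trace_mul ℓ b m β ρ hb hρ hℓ g]

/-- **`|G| · dim B_W(Y ⊗ M) = (Σ_g c_W(g) tr m(g)) · dim Y`** over ANY field, for every isotypical component `B_W(Y ⊗ M) = Im u_W`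
of the untwisted tensor (`ι_j ρ(g) π_i = m(g)_{ij} • 𝟙`): `Σ_g c_W(g) tr m(g) = |G|² ⟨e_W, χ_M⟩ = |G| · dim_ℚ (e_W M_ℚ)`, so
`dim B_W(Y ⊗ M) = dim_ℚ(e_W M_ℚ) · dim Y` — the isotypical component is the twist `Y ⊗ (M ∩ e_W M_ℚ)` up to isogeny
(`Res V ∼ ⊕_ρ I_ρ ⊗ V`).  Proof: an auxiliary prime `ℓ` invertible in `K`, the previous formula and `Tr(𝟙 | T_ℓ Y) = 2 dim Y`.
[cite: LangeRodriguez2022, §2.9.1 Thm. 2.9.1 and Prop. 2.9.3 (PDF pp. 43, 46)] [cite: MazurRubinSilverberg2007, Def. 4.3 and Thm. 4.5]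
[cite: SerreLinearRepresentations1977, §2.6 Thm. 8] -/
theorem card_mul_dim_isotypical_eq (hb : ∑ j, b.π j ≫ b.ι j = 𝟙 b.pt)
    (hρ₁ : ∀ (g : G) (i j : ι), b.ι j ≫ End.asHom (ρ g) ≫ b.π i = m g i j • 𝟙 Y) (e : ratCharIdempotents G) :
    ((Fintype.card G * (image (u e)).dim : ℕ) : ℤ) = (∑ g, c e g * (m g).trace) * Y.dim := by
  obtain ⟨ℓ, hℓp, hℓ⟩ := exists_prime_natCast_ne_zero (K := K)
  haveI : Fact ℓ.Prime := ⟨hℓp⟩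
  have key := card_mul_two_mul_dim_isotypical_eq_sum ℓ ρ hc hu hℓ e
  simp_rw [trace_tateModuleMap_asHom_eq_trace_mul_dim ℓ b m ρ hb hρ₁ hℓ] at key
  push_cast at key
  simp_rw [← mul_assoc] at key
  rw [← Finset.sum_mul, ← Finset.sum_mul] at key
  have key' : (((Fintype.card G * (image (u e)).dim : ℕ) : ℤ) : ℤ_[ℓ]) * 2 =
      ((((∑ g, c e g * (m g).trace) * Y.dim : ℤ)) : ℤ_[ℓ]) * 2 := by
    push_cast
    linear_combination key
  exact_mod_cast (mul_left_injective₀ (two_ne_zero' ℤ_[ℓ]) key' : _)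

/-- **`dim B_W(Y ⊗ M) = d · dim Y` whenever `|G| · d = Σ_g c_W(g) tr m(g)`** (`d = dim_ℚ e_W M_ℚ`; any field, untwisted tensor).
[cite: LangeRodriguez2022, §2.9.1 Prop. 2.9.3 (PDF p. 46)] [cite: MazurRubinSilverberg2007, Def. 4.3, Thm. 4.5 and Thm. 2.1 (i)] -/
theorem dim_isotypical_eq_of_card_mul_eq (hb : ∑ j, b.π j ≫ b.ι j = 𝟙 b.pt)
    (hρ₁ : ∀ (g : G) (i j : ι), b.ι j ≫ End.asHom (ρ g) ≫ b.π i = m g i j • 𝟙 Y) (e : ratCharIdempotents G) {d : ℕ}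
    (hd : (Fintype.card G : ℤ) * d = ∑ g, c e g * (m g).trace) :
    (image (u e)).dim = d * Y.dim := by
  have h := card_mul_dim_isotypical_eq b m ρ hc hu hb hρ₁ e
  rw [← hd, mul_assoc, Nat.cast_mul] at h
  exact_mod_cast mul_left_cancel₀ (Nat.cast_ne_zero.2 Fintype.card_ne_zero : (Fintype.card G : ℤ) ≠ 0) h

/-- **VANISHING CRITERION `B_W(Y ⊗ M) = 0 ⟺ dim Y = 0 ∨ Σ_g c_W(g) tr m(g) = 0`** (any field, untwisted tensor): the isotypical
component at `W` vanishes iff `Y = 0` or `W` does not occur in `M_ℚ` ("`dim B = 0` if and only if `⟨ρ, W⟩ = 0`").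
[cite: LangeRodriguez2022, §2.9.1 Thm. 2.9.1 and Prop. 2.9.3 (ii) (PDF pp. 43, 46)] [cite: MazurRubinSilverberg2007, Thm. 4.5] -/
theorem dim_isotypical_eq_zero_iff_of_blocks (hb : ∑ j, b.π j ≫ b.ι j = 𝟙 b.pt)
    (hρ₁ : ∀ (g : G) (i j : ι), b.ι j ≫ End.asHom (ρ g) ≫ b.π i = m g i j • 𝟙 Y) (e : ratCharIdempotents G) :
    (image (u e)).dim = 0 ↔ Y.dim = 0 ∨ ∑ g, c e g * (m g).trace = 0 := by
  have h := card_mul_dim_isotypical_eq b m ρ hc hu hb hρ₁ e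
  have hG : (Fintype.card G : ℤ) ≠ 0 := Nat.cast_ne_zero.2 Fintype.card_ne_zero
  rw [Nat.cast_mul] at h
  constructor
  · intro h0
    rw [h0, Nat.cast_zero, mul_zero] at h
    rcases mul_eq_zero.1 h.symm with h1 | h1
    · exact Or.inr h1
    · exact Or.inl (by exact_mod_cast h1)
  · rintro (h0 | h0)
    · rw [h0, Nat.cast_zero, mul_zero] at h
      exact_mod_cast (mul_eq_zero.1 h).resolve_left hG
    · rw [h0, zero_mul] at h
      exact_mod_cast (mul_eq_zero.1 h).resolve_left hG

end Isotypical

end LatticeTensor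

end AbelianVariety

end Literature.AlgebraicGeometry.Motives
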